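import Summits.AtomisticToContinuum.FouriersLaw.Theorems.OddSectorIrreversibilityCorrectorTheoryTangentCurrent
import Summits.AtomisticToContinuum.FouriersLaw.Theorems.OddSectorIrreversibilityCorrectorTheoryBondSum
import Summits.AtomisticToContinuum.FouriersLaw.Theorems.JunctionLocalitySuperadditiveResistanceStubPlainKuboLinkAux1
import Summits.AtomisticToContinuum.FouriersLaw.Theorems.BondHeatUncertaintySubdiffusiveBondHeatKernelGibbsA

/-!
# `CorrectorTheory` (stmt-AtomisticToContinuum-14071), part 7d: parity split and energy-class bounds for the leak identity

Helper file for support item `stmt-AtomisticToContinuum-14071`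
(`OddSectorIrreversibility.CorrectorTheory`, conjunct A (7)).

Setting: `P = pinnedChain ω₂ lam β γ` (all `> 0`), `T > 0`, `ρ = e^{-H/T}`, a smooth `u` with
`u, k ∈ L²(μ_T)`, `k` continuous and ODD, `L_{T,T} u = -k` pointwise; `Θ(q,p) = (q,-p)`,
`u⁻ = (u - u∘Θ)/2`, `u⁺ = (u + u∘Θ)/2`; the closed flow `Φ_s` and `g_s = j_i ∘ Φ_s`.

* `liouvilleOp_oddPart` — **the parity split of the Poisson equation**: `X_H u⁻ = -γ S u⁺`
  (`X_H` is odd, `S` even under `Θ`, `k` odd);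
* `memLp_partialP_evenPart`, `memLp_oddPart` — `u⁻, ∂_{p_b} u⁺ ∈ L²(μ_T)` at the bath sites;
* `exists_abs_liouvilleOp_bondCurrent_le` — `|X_H j_i| ≤ C (1 + H)³` (polynomial energy class);
* the fixed-time leak identity itself is in part 7d′ (`…CorrectorTheoryLeakFixedTime.lean`).

References: Kundu–Dhar–Narayan 2009 (reln2)–(reln3); folklore. Nothing here closes the item.
-/

noncomputable section

open MeasureTheory Filter Topology Set Function Metric
open scoped ContDiff NNReal ENNReal
open Literature.MathematicalPhysics.KineticTheory.HeatConduction
open Literature.MathematicalPhysics.KineticTheory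
open Summit.AtomisticToContinuum.FouriersLaw.Theorems.ClosedConeSensitivity.Negative.ZeroFrictionDictionary
open Summit.AtomisticToContinuum.FouriersLaw.Theorems.ClosedConeSensitivity.Negative.TangentReduction
open Summit.AtomisticToContinuum.FouriersLaw.Theorems.SuperadditiveResistance.DeviceLiouville
open Summit.AtomisticToContinuum.FouriersLaw.Theorems.SuperadditiveResistance.Kubo
open Summit.AtomisticToContinuum.FouriersLaw.Theorems.SubBallisticWindow.StaticCurrentBound
open Summit.AtomisticToContinuum.FouriersLaw.Cruxes.SuperadditiveResistance.FloatingProbeBypassLaplacian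
open Summit.AtomisticToContinuum.FouriersLaw.Theorems.SubdiffusiveBondHeat

namespace Summit.AtomisticToContinuum.FouriersLaw.Theorems.OddSectorIrreversibility.Corrector

variable {N : ℕ}

/-! ### Linearity of `X_H` and `S_B` -/

/-- `X_H (c f) = c X_H f`. [folklore] -/
theorem liouvilleOp_const_mul (P : OscillatorChain) (c : ℝ) (f : PhaseSpace N → ℝ) (x : PhaseSpace N) :
    liouvilleOp P N (fun y => c * f y) x = c * liouvilleOp P N f x := by
  unfold liouvilleOp
  rw [Finset.mul_sum]
  refine Finset.sum_congr rfl fun i _ => ?_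
  rw [Literature.MathematicalPhysics.KineticTheory.HeatConduction.partialQ_const_mul,
    Literature.MathematicalPhysics.KineticTheory.HeatConduction.partialP_const_mul]
  ring

/-- `S_B (c f) = c S_B f`. [folklore] -/
theorem bathOp_const_mul (B : Fin N → ℝ) (T c : ℝ) (f : PhaseSpace N → ℝ) (x : PhaseSpace N) :
    bathOp N B T (fun y => c * f y) x = c * bathOp N B T f x := by
  unfold bathOp
  rw [Finset.mul_sum]
  refine Finset.sum_congr rfl fun i _ => ?_
  have h1 : partialP i (fun y => c * f y) = fun y => c * partialP i f y :=
    funext fun y => Literature.MathematicalPhysics.KineticTheory.HeatConduction.partialP_const_mul c f i y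
  rw [h1, Literature.MathematicalPhysics.KineticTheory.HeatConduction.partialP_const_mul]
  ring

/-- `S_B (f + g) = S_B f + S_B g` on `C²`. [folklore] -/
theorem bathOp_add {f g : PhaseSpace N → ℝ} (hf : ContDiff ℝ 2 f) (hg : ContDiff ℝ 2 g)
    (B : Fin N → ℝ) (T : ℝ) (x : PhaseSpace N) :
    bathOp N B T (fun y => f y + g y) x = bathOp N B T f x + bathOp N B T g x := by
  have h := bathOp_sub hf hg.neg B T x
  have e1 : (fun y => f y - -g y) = fun y => f y + g y := funext fun y => by ring
  have e2 : bathOp N B T (fun y => -g y) x = -bathOp N B T g x := by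
    have := bathOp_const_mul B T (-1) g x
    simp only [neg_mul, one_mul] at this
    exact this
  rw [e1, e2] at h
  linarith

/-- `X_H (f + g) = X_H f + X_H g`. [folklore] -/
theorem liouvilleOp_add (P : OscillatorChain) {f g : PhaseSpace N → ℝ} (hf : Differentiable ℝ f)
    (hg : Differentiable ℝ g) (x : PhaseSpace N) :
    liouvilleOp P N (fun y => f y + g y) x = liouvilleOp P N f x + liouvilleOp P N g x := by
  have hg' : Differentiable ℝ fun y => -g y := hg.neg
  have h := liouvilleOp_sub (P := P) hf hg' x
  have e1 : (fun y => f y - -g y) = fun y => f y + g y := funext fun y => by ring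
  have e2 : liouvilleOp P N (fun y => -g y) x = -liouvilleOp P N g x := by
    have := liouvilleOp_const_mul P (-1) g x
    simp only [neg_mul, one_mul] at this
    exact this
  rw [e1, e2] at h
  linarith

/-! ### Parity split of the Poisson equation -/

/-- **`X_H u⁻ = -γ S u⁺`**: the even part of `L u = -k` for an odd source `k` and `u ∈ C²`
(`L = X_H + γ S`, `X_H` odd and `S` even under the momentum flip). [folklore] -/
theorem liouvilleOp_oddPart (P : OscillatorChain) (T : ℝ) {u k : PhaseSpace N → ℝ} (hu : ContDiff ℝ 2 u)
    (hkodd : ∀ x : PhaseSpace N, k (x.1, -x.2) = -k x)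
    (hpde : ∀ x, P.generator N T T u x = -k x) (x : PhaseSpace N) :
    liouvilleOp P N (fun y => (u y - u (y.1, -y.2)) / 2) x =
      -P.γ * bathOp N (OscillatorChain.bathWeight N) T (fun y => (u y + u (y.1, -y.2)) / 2) x := by
  set B := OscillatorChain.bathWeight N with hB
  set uΘ : PhaseSpace N → ℝ := fun y => u (y.1, -y.2) with huΘ
  have huΘs : ContDiff ℝ 2 uΘ := contDiff_flip hu
  have hud : Differentiable ℝ u := hu.differentiable two_ne_zero
  have huΘd : Differentiable ℝ uΘ := huΘs.differentiable two_ne_zero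
  -- rewrite the halves
  have e1 : (fun y => (u y - u (y.1, -y.2)) / 2) = fun y => (1 / 2 : ℝ) * (u y - uΘ y) := by
    funext y; simp only [huΘ]; ring
  have e2 : (fun y => (u y + u (y.1, -y.2)) / 2) = fun y => (1 / 2 : ℝ) * (u y + uΘ y) := by
    funext y; simp only [huΘ]; ring
  rw [e1, e2, liouvilleOp_const_mul, bathOp_const_mul, liouvilleOp_sub hud huΘd,
    bathOp_add hu huΘs]
  -- the Poisson equation in operator form, at `x` and at `Θ x`
  have hpde' : ∀ y, liouvilleOp P N u y = -k y - P.γ * bathOp N B T u y := fun y => by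
    have := hpde y; rw [generator_eq_liouvilleOp_add] at this
    change liouvilleOp P N u y + P.γ * bathOp N B T u y = -k y at this; linarith
  have hX : liouvilleOp P N uΘ x = -liouvilleOp P N u (x.1, -x.2) := liouvilleOp_flip P u x
  have hS : bathOp N B T uΘ x = bathOp N B T u (x.1, -x.2) := bathOp_flip B T u x
  rw [hX, hS, hpde' x, hpde' (x.1, -x.2), hkodd x]
  ring

/-! ### `L²` facts for the odd part and the bath derivatives of the even part -/

section L2

variable {ω₂ lam β γ : ℝ} {T : ℝ}

/-- `u⁻ ∈ L²(μ_T)` if `u ∈ L²(μ_T)`. [folklore] -/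
theorem memLp_oddPart {u : PhaseSpace N → ℝ} (hu2 : MemLp u 2 ((pinnedChain ω₂ lam β γ).gibbsMeasure N T)) :
    MemLp (fun y => (u y - u (y.1, -y.2)) / 2) 2 ((pinnedChain ω₂ lam β γ).gibbsMeasure N T) := by
  have h := (hu2.sub (memLp_flip_gibbsMeasure _ N T hu2)).const_mul (1 / 2)
  refine h.congr_norm ?_ (Eventually.of_forall fun y => ?_)
  · exact h.aestronglyMeasurable.congr (Eventually.of_forall fun y => by simp only [Pi.sub_apply]; ring)
  · simp only [Pi.sub_apply]; ring_nf

/-- `u⁺ ∈ C^∞` if `u` is. [folklore] -/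
theorem contDiff_evenPart {u : PhaseSpace N → ℝ} (hu : ContDiff ℝ ∞ u) :
    ContDiff ℝ ∞ fun y : PhaseSpace N => (u y + u (y.1, -y.2)) / 2 :=
  (hu.add (contDiff_flip hu)).div_const 2

/-- `u⁻ ∈ C^∞` if `u` is. [folklore] -/
theorem contDiff_oddPart {u : PhaseSpace N → ℝ} (hu : ContDiff ℝ ∞ u) :
    ContDiff ℝ ∞ fun y : PhaseSpace N => (u y - u (y.1, -y.2)) / 2 :=
  (hu.sub (contDiff_flip hu)).div_const 2

variable (hω : 0 < ω₂) (hl : 0 ≤ lam) (hβ : 0 ≤ β) (hγ : 0 < γ) (hT : 0 < T)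
include hω hl hβ hγ hT


/-- `∂_{p_b} u⁺ ∈ L²(μ_T)` at the bath sites, for a smooth `u ∈ L²(μ_T)` with `L u = -k`,
`k ∈ L²(μ_T)`. [folklore] -/
theorem memLp_partialP_evenPart {u k : PhaseSpace N → ℝ} (hu : ContDiff ℝ ∞ u)
    (hu2 : MemLp u 2 ((pinnedChain ω₂ lam β γ).gibbsMeasure N T))
    (hk2 : MemLp k 2 ((pinnedChain ω₂ lam β γ).gibbsMeasure N T))
    (hpde : ∀ x, (pinnedChain ω₂ lam β γ).generator N T T u x = -k x) {b : Fin N}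
    (hb : 0 < OscillatorChain.bathWeight N b) :
    MemLp (partialP b fun y : PhaseSpace N => (u y + u (y.1, -y.2)) / 2) 2 ((pinnedChain ω₂ lam β γ).gibbsMeasure N T) := by
  have hud : Differentiable ℝ u := hu.differentiable (by simp)
  have hdb := memLp_partialP_of_poisson hω hl hβ hγ hT (hu.of_le (by norm_cast)) hu2 hk2 hpde hb
  have hflip : MemLp (fun y : PhaseSpace N => partialP b u (y.1, -y.2)) 2 ((pinnedChain ω₂ lam β γ).gibbsMeasure N T) :=
    memLp_flip_gibbsMeasure _ N T hdb
  have e : partialP b (fun y : PhaseSpace N => (u y + u (y.1, -y.2)) / 2) =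
      fun y => (1 / 2 : ℝ) * (partialP b u y - partialP b u (y.1, -y.2)) := by
    funext y
    have e1 : (fun y : PhaseSpace N => (u y + u (y.1, -y.2)) / 2) = fun y => (1 / 2 : ℝ) * (u y + u (y.1, -y.2)) := by
      funext z; ring
    rw [e1, Literature.MathematicalPhysics.KineticTheory.HeatConduction.partialP_const_mul,
      show (fun y : PhaseSpace N => u y + u (y.1, -y.2)) = u + fun y => u (y.1, -y.2) from rfl,
      Literature.MathematicalPhysics.KineticTheory.HeatConduction.partialP_add hud
        ((contDiff_flip hu).differentiable (by simp)),
      partialP_flip]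
    ring
  rw [e]
  exact (hdb.sub hflip).const_mul _

end L2

/-! ### `X_H j_i` is of polynomial energy class -/

section Liouville

variable {ω₂ lam β : ℝ} (hω : 0 < ω₂) (hl : 0 ≤ lam) (hβ : 0 ≤ β) (γ : ℝ)
include hω hl hβ

/-- `‖X_H(z)‖ ≤ C (1 + H(z))` for the Hamiltonian field of the pinned chain (sup norm; the
force is dominated by the energy, the momenta by `1 + H`). [folklore] -/
theorem exists_norm_hamField_le (N : ℕ) : ∃ C : ℝ, 0 ≤ C ∧ ∀ z : PhaseSpace N,
    ‖hamField (pinnedChain ω₂ lam β γ) N z‖ ≤ C * (1 + (pinnedChain ω₂ lam β γ).hamiltonian N z) := by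
  set P := pinnedChain ω₂ lam β γ with hP
  have hPc : (pinnedChain ω₂ lam β 0).IsConfining := pinnedChain_isConfining hω hl hβ le_rfl
  obtain ⟨A, hA0, hA⟩ := hPc.exists_abs_deriv_U_le
  obtain ⟨B, hB0, hB⟩ := hPc.exists_abs_deriv_V_le
  have hU0 : ∀ q, 0 ≤ P.U q := fun q => by show 0 ≤ ω₂ * q ^ 2 / 2 + lam * q ^ 4 / 4; positivity
  have hV0 : ∀ r, 0 ≤ P.V r := fun r => by show 0 ≤ r ^ 2 / 2 + β * r ^ 4 / 4; positivity
  refine ⟨1 + (A + N ^ 2 * B), by positivity, fun z => ?_⟩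
  have hH0 : 0 ≤ P.hamiltonian N z := P.hamiltonian_nonneg_of_nonneg hU0 hV0 N z
  have hUV : ∀ q, (pinnedChain ω₂ lam β 0).U q = P.U q := fun q => rfl
  have hA' : ∀ q, |deriv P.U q| ≤ A * (1 + P.U q) := hA
  have hB' : ∀ r, |deriv P.V r| ≤ B * (1 + P.V r) := hB
  rw [hamField, Prod.norm_def, max_le_iff]
  constructor
  · have h1 : ‖z.2‖ ≤ 1 + P.hamiltonian N z :=
      (pi_norm_le_iff_of_nonneg (by positivity)).2 fun i => by
        rw [Real.norm_eq_abs]; exact abs_momentum_le hω.le hl hβ γ N z i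
    have hAB : 0 ≤ (A + N ^ 2 * B) * (1 + P.hamiltonian N z) := by positivity
    calc ‖z.2‖ ≤ 1 + P.hamiltonian N z := h1
      _ ≤ (1 + (A + N ^ 2 * B)) * (1 + P.hamiltonian N z) := by nlinarith
  · refine (pi_norm_le_iff_of_nonneg (by positivity)).2 fun i => ?_
    rw [Real.norm_eq_abs, abs_neg]
    have h := P.abs_dPotential_le hA0 hB0 hA' hB' hU0 hV0 N z i
    nlinarith

/-- **`|X_H j_i(z)| ≤ C (1 + H(z))³`** for some `C ≥ 0`. [folklore] -/
theorem exists_abs_liouvilleOp_bondCurrent_le (N : ℕ) (i : Fin N) : ∃ C : ℝ, 0 ≤ C ∧ ∀ z : PhaseSpace N,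
    |liouvilleOp (pinnedChain ω₂ lam β γ) N (fun y => (pinnedChain ω₂ lam β γ).bondCurrent N i y) z| ≤
      C * (1 + (pinnedChain ω₂ lam β γ).hamiltonian N z) ^ 3 := by
  set P := pinnedChain ω₂ lam β γ with hP
  obtain ⟨C, hC0, hC⟩ := exists_norm_hamField_le hω hl hβ γ N
  have hU : Differentiable ℝ P.U := (pinnedChain_contDiff_U ω₂ lam β γ (n := 1)).differentiable one_ne_zero
  have hV : Differentiable ℝ P.V := (pinnedChain_contDiff_V ω₂ lam β γ (n := 1)).differentiable one_ne_zero
  have hjd : Differentiable ℝ fun y => P.bondCurrent N i y :=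
    (contDiff_bondCurrent _ (pinnedChain_contDiff_V ω₂ lam β γ) N i).differentiable (by simp)
  have hU0 : ∀ q, 0 ≤ P.U q := fun q => by show 0 ≤ ω₂ * q ^ 2 / 2 + lam * q ^ 4 / 4; positivity
  have hV0 : ∀ r, 0 ≤ P.V r := fun r => by show 0 ≤ r ^ 2 / 2 + β * r ^ 4 / 4; positivity
  refine ⟨(5 + 13 * β) * C, by positivity, fun z => ?_⟩
  have hH0 : 0 ≤ P.hamiltonian N z := P.hamiltonian_nonneg_of_nonneg hU0 hV0 N z
  rw [liouvilleOp_eq_fderiv P hU hV hjd, ← Real.norm_eq_abs]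
  calc ‖fderiv ℝ (fun y => P.bondCurrent N i y) z (hamField P N z)‖
      ≤ ‖fderiv ℝ (fun y => P.bondCurrent N i y) z‖ * ‖hamField P N z‖ := ContinuousLinearMap.le_opNorm _ _
    _ ≤ ((5 + 13 * β) * (1 + P.hamiltonian N z) ^ 2) * (C * (1 + P.hamiltonian N z)) :=
        mul_le_mul (norm_fderiv_bondCurrent_le hω.le hl hβ γ N i z) (hC z) (norm_nonneg _) (by positivity)
    _ = (5 + 13 * β) * C * (1 + P.hamiltonian N z) ^ 3 := by ring

end Liouville

end Summit.AtomisticToContinuum.FouriersLaw.Theorems.OddSectorIrreversibility.Corrector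

end
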